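import Mathlib.RingTheory.Nilpotent.Basic
import Literature.InformationTheory.QuantumCodes.AbelianTwoBlockPaddedLogicals
import HarnessLib

/-!
# Tools for the cyclic kernel-weight theorem of abelian two-block codes: chain-ring induction, transversal lemma,
# and the bridge `(G → 𝔽₂, ⋆) ≅ AddMonoidAlgebra 𝔽₂ G`

This module collects the generic ingredients of `Census/TwoBlockCyclicKernel.lean` (qec cell, FINDINGS X-2 programme:
«for an abelian two-block code `css a b`, does a subgroup indicator `1_H ∈ ker A ∩ ker B` force `d ≤ |H|`?» — yes for cyclic
2-groups `H`, no for `H ≅ ℤ₂ × ℤ₂`):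

* `pow_eq_zero_of_both_trivial` — the abstract CORE in any commutative ring: if `Ann(η) ⊆ (η^{q-1})`, `η^{q-1} η = 0`,
  `a η^{q-1} = b η^{q-1} = 0` and both systems `η^{q-1} = b s, a s = 0` and `η^{q-1} = a s', b s' = 0` are solvable, then
  `η^{q-1} = 0` (chain-ring induction: `a, b ∈ (η^i)` for `i = 1, …, q`, via `exists_eq_pow_mul_of_mul_pow_eq_zero`:
  `Ann(η^i) ⊆ (η^{q-i})`, and the units `1 + ηρ`);
* `exists_conv_indH_eq` — the TRANSVERSAL LEMMA: a function `G → 𝔽₂` constant on the cosets of a subgroup `H` is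
  `1_H ⋆ x₀` (`x₀` = restriction to one representative per coset, chosen by an enumeration of `G`); `indH H = 1_H`;
* `toAlg`, `coe_coeff_mul`, `toAlg_conv`, … — the bridge identifying the convolution `u ⋆ v = circulant u *ᵥ v` of
  `AbelianTwoBlockPaddedLogicals.lean` with the product of Mathlib's `AddMonoidAlgebra (ZMod 2) G` (re-proving qec-lit-3's
  private bridge there), so that `ring` and powers are available;
* `one_add_pow_two_pow`, `prod_one_add_pow_two_pow`, `one_add_pow_two_pow_sub_one` — characteristic-2 identities
  `(1 + Y)^{2^j} = 1 + Y^{2^j}` and `(1 + Y)^{2^r − 1} = ∏_{j<r}(1 + Y^{2^j}) = Σ_{l<2^r} Y^l`.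

HONEST FRAMING: elementary algebra (folklore), packaged for one use; nothing printed is formalized here. All proved, axioms
standard, 0 kit.
-/

namespace Summit.Ventures.QEC.TwoBlockCyclicKernel

open Matrix Literature.InformationTheory.QuantumCodes Literature.InformationTheory.QuantumCodes.AbelianTwoBlock

/-! ## The abstract core: chain-ring induction -/

section Core

variable {R : Type*} [CommRing R]

/-- `Ann(η) ⊆ (η^(q-1))` propagates: `x η^i = 0 ⇒ x ∈ (η^(q-i))` for all `i ≤ q`, given `η^q = 0`. -/
theorem exists_eq_pow_mul_of_mul_pow_eq_zero (η : R) (q : ℕ)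
    (hP : ∀ x : R, x * η = 0 → ∃ x₀, x = η ^ (q - 1) * x₀) :
    ∀ i ≤ q, ∀ x : R, x * η ^ i = 0 → ∃ x₀, x = η ^ (q - i) * x₀ := by
  intro i
  induction i with
  | zero =>
    intro _ x hx
    refine ⟨0, ?_⟩
    rw [pow_zero, mul_one] at hx
    rw [hx, mul_zero]
  | succ i ih =>
    intro hi x hx
    have hi' : i ≤ q := Nat.le_of_succ_le hi
    -- (x η) η^i = 0
    have h1 : (x * η) * η ^ i = 0 := by rw [mul_assoc, ← pow_succ', hx]
    obtain ⟨x₁, hx₁⟩ := ih hi' (x * η) h1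
    -- q - i = (q - (i+1)) + 1
    have hqi : q - i = (q - (i + 1)) + 1 := by omega
    rw [hqi, pow_succ] at hx₁
    -- (x - η^(q-i-1) x₁) η = 0
    have h2 : (x - η ^ (q - (i + 1)) * x₁) * η = 0 := by
      rw [sub_mul, hx₁]; ring
    obtain ⟨x₂, hx₂⟩ := hP _ h2
    refine ⟨x₁ + η ^ i * x₂, ?_⟩
    have hq1 : q - 1 = (q - (i + 1)) + i := by omega
    rw [hq1, pow_add] at hx₂
    calc x = (x - η ^ (q - (i + 1)) * x₁) + η ^ (q - (i + 1)) * x₁ := by ring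
      _ = η ^ (q - (i + 1)) * η ^ i * x₂ + η ^ (q - (i + 1)) * x₁ := by rw [hx₂]
      _ = η ^ (q - (i + 1)) * (x₁ + η ^ i * x₂) := by ring

/-- `1 + η ρ` is a unit when `η` is nilpotent. -/
theorem isUnit_one_add_mul_of_pow_eq_zero {η : R} {q : ℕ} (hq0 : η ^ q = 0) (ρ : R) : IsUnit (1 + η * ρ) := by
  have hnil : IsNilpotent (η * ρ) := ⟨q, by rw [mul_pow, hq0, zero_mul]⟩
  exact hnil.isUnit_one_add

/-- **Core lemma (chain-ring induction).**  In a commutative ring let `η` satisfy `Ann(η) ⊆ (N)` with `N = η^(q-1)`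
and `N η = 0` (so `η^q = 0`).  If `a N = b N = 0` and BOTH `N = b s, a s = 0` and `N = a s', b s' = 0` are solvable,
then `N = 0`.  (Induction: `a, b ∈ (η^i)` for `i = 1, …, q`.) -/
theorem pow_eq_zero_of_both_trivial (η : R) (q : ℕ) (hq : 1 ≤ q)
    (hP : ∀ x : R, x * η = 0 → ∃ x₀, x = η ^ (q - 1) * x₀) (hNη : η ^ (q - 1) * η = 0)
    {a b s s' : R} (ha : a * η ^ (q - 1) = 0) (hb : b * η ^ (q - 1) = 0)
    (h1 : b * s = η ^ (q - 1)) (h2 : a * s = 0) (h3 : a * s' = η ^ (q - 1)) (h4 : b * s' = 0) :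
    η ^ (q - 1) = 0 := by
  have hq0 : η ^ q = 0 := by
    have : q = (q - 1) + 1 := by omega
    rw [this, pow_succ, hNη]
  have F1 := exists_eq_pow_mul_of_mul_pow_eq_zero η q hP
  -- one induction step, stated for a generic pair (c, d) with data (t): c, d ∈ (η^i), d t = N, c t = 0 ⇒ c ∈ (η^(i+1))
  have step : ∀ i, 1 ≤ i → i + 1 ≤ q → ∀ c d t : R, (∃ γ, c = η ^ i * γ) → (∃ δ, d = η ^ i * δ) →
      d * t = η ^ (q - 1) → c * t = 0 → ∃ γ', c = η ^ (i + 1) * γ' := by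
    intro i hi1 hiq c d t ⟨γ, hγ⟩ ⟨δ, hδ⟩ hdt hct
    -- j := q - 1 - i
    set j := q - 1 - i with hj
    have hij : q - 1 = i + j := by omega
    have hqi : q - i = j + 1 := by omega
    have hqj : q - j = i + 1 := by omega
    -- δ t - η^j ∈ Ann(η^i) ⇒ δ t = η^j (1 + η ρ)
    have e1 : (δ * t - η ^ j) * η ^ i = 0 := by
      have : η ^ i * (δ * t) = η ^ i * η ^ j := by rw [← mul_assoc, ← hδ, hdt, hij, pow_add]
      rw [sub_mul, mul_comm, this]; ring
    obtain ⟨ρ, hρ⟩ := F1 i (by omega) _ e1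
    rw [hqi, pow_succ] at hρ
    -- γ t ∈ Ann(η^i) ⇒ γ t = η^(j+1) σ
    have e2 : (γ * t) * η ^ i = 0 := by
      have : η ^ i * (γ * t) = 0 := by rw [← mul_assoc, ← hγ, hct]
      rw [mul_comm, this]
    obtain ⟨σ, hσ⟩ := F1 i (by omega) _ e2
    rw [hqi, pow_succ] at hσ
    -- η^j (γ (1 + η ρ) - η δ σ) = 0
    have e3 : (γ * (1 + η * ρ) - η * (δ * σ)) * η ^ j = 0 := by
      have hγδ : γ * (δ * t) = δ * (γ * t) := by ring
      have lhs : γ * (δ * t) = η ^ j * (γ * (1 + η * ρ)) := by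
        rw [show δ * t = (δ * t - η ^ j) + η ^ j by ring, hρ]; ring
      have rhs : δ * (γ * t) = η ^ j * (η * (δ * σ)) := by rw [hσ]; ring
      rw [mul_comm, mul_sub, ← lhs, ← rhs, hγδ, sub_self]
    obtain ⟨τ, hτ⟩ := F1 j (by omega) _ e3
    rw [hqj] at hτ
    -- γ (1 + ηρ) = η (δ σ + η^i τ), invert the unit
    obtain ⟨u, hu⟩ := isUnit_one_add_mul_of_pow_eq_zero hq0 ρ
    refine ⟨(δ * σ + η ^ i * τ) * ↑u⁻¹, ?_⟩
    have hγ' : γ * (1 + η * ρ) = η * (δ * σ + η ^ i * τ) := by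
      rw [show γ * (1 + η * ρ) = (γ * (1 + η * ρ) - η * (δ * σ)) + η * (δ * σ) by ring, hτ]; ring
    have hγ'' : γ = η * (δ * σ + η ^ i * τ) * ↑u⁻¹ := by
      rw [← hγ', ← hu, mul_assoc, Units.mul_inv, mul_one]
    rw [hγ, hγ'', pow_succ]; ring
  -- the induction: a, b ∈ (η^i) for 1 ≤ i ≤ q
  have main : ∀ i, 1 ≤ i → i ≤ q → (∃ α, a = η ^ i * α) ∧ (∃ β, b = η ^ i * β) := by
    intro i hi1
    induction i with
    | zero => exact absurd hi1 (by omega)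
    | succ i ih =>
      intro hiq
      by_cases hi0 : i = 0
      · subst hi0
        -- base: from a N = 0, b N = 0 via F1 (q-1)
        have hq1 : q - (q - 1) = 0 + 1 := by omega
        obtain ⟨α, hα⟩ := F1 (q - 1) (by omega) a ha
        obtain ⟨β, hβ⟩ := F1 (q - 1) (by omega) b hb
        rw [hq1] at hα hβ
        exact ⟨⟨α, hα⟩, ⟨β, hβ⟩⟩
      · have hi1' : 1 ≤ i := by omega
        obtain ⟨hA, hB⟩ := ih hi1' (by omega)
        exact ⟨step i hi1' hiq a b s hA hB h1 h2, step i hi1' hiq b a s' hB hA h3 h4⟩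
  obtain ⟨⟨α, hα⟩, -⟩ := main q hq le_rfl
  rw [← h3, hα, hq0, zero_mul, zero_mul]

end Core

/-! ## The transversal lemma: `H`-periodic functions are `1_H ⋆ x₀` -/

section Transversal

variable {G : Type*} [AddCommGroup G] [Fintype G] [DecidableEq G]

/-- The indicator `1_H : G → 𝔽₂` of a subgroup (decidable membership). (definition) -/
def indH (H : AddSubgroup G) [DecidablePred (· ∈ H)] : G → ZMod 2 := fun g => if g ∈ H then 1 else 0

omit [DecidableEq G] in
/-- `(1_H ⋆ x)(g) = Σ_{u : g - u ∈ H} x u` — convolution with `1_H` sums over the coset of `g`. -/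
theorem conv_indH_apply (H : AddSubgroup G) [DecidablePred (· ∈ H)] (x : G → ZMod 2) (g : G) :
    (circulant (indH H) *ᵥ x) g = ∑ u ∈ Finset.univ.filter (fun u => g - u ∈ H), x u := by
  simp only [Matrix.mulVec, dotProduct, circulant_apply, indH]
  rw [Finset.sum_filter]
  refine Finset.sum_congr rfl fun u _ => ?_
  split_ifs <;> simp

/-- **Transversal lemma.**  A function that is constant on the cosets of a subgroup `H` is `1_H ⋆ x₀` for the restriction
`x₀` of `x` to a transversal (one representative per coset, chosen with an enumeration of `G`). -/
theorem exists_conv_indH_eq (H : AddSubgroup G) [DecidablePred (· ∈ H)] {x : G → ZMod 2}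
    (hx : ∀ g h, h ∈ H → x (g + h) = x g) : ∃ x₀ : G → ZMod 2, circulant (indH H) *ᵥ x₀ = x := by
  classical
  -- a linear order on `G` from an enumeration
  letI : LinearOrder G := LinearOrder.lift' (Fintype.equivFin G) (Fintype.equivFin G).injective
  -- the coset of `g` as a Finset, and its least element
  let C : G → Finset G := fun g => Finset.univ.filter (fun u => g - u ∈ H)
  have hCne : ∀ g, (C g).Nonempty := fun g => ⟨g, by simp [C, H.zero_mem]⟩
  let rep : G → G := fun g => (C g).min' (hCne g)
  have hmemC : ∀ g u, u ∈ C g ↔ g - u ∈ H := fun g u => by simp [C]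
  have hCeq : ∀ g u, g - u ∈ H → C u = C g := by
    intro g u hgu
    ext v
    rw [hmemC, hmemC]
    constructor
    · intro h; have := H.add_mem hgu h; rwa [sub_add_sub_cancel] at this
    · intro h; have := H.sub_mem h hgu; rwa [sub_sub_sub_cancel_left] at this
  have hrep_mem : ∀ g, g - rep g ∈ H := fun g => (hmemC g (rep g)).mp (Finset.min'_mem _ _)
  have hrep_eq : ∀ g u, g - u ∈ H → rep u = rep g := by
    intro g u hgu
    simp only [rep]
    congr 1
    exact hCeq g u hgu
  refine ⟨fun u => if rep u = u then x u else 0, ?_⟩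
  funext g
  rw [conv_indH_apply]
  -- the sum over the coset picks exactly the representative
  have hsingle : ∀ u ∈ C g, u ≠ rep g → (if rep u = u then x u else 0) = 0 := by
    intro u hu hne
    rw [if_neg]
    intro hru
    exact hne (by rw [← hru, hrep_eq g u ((hmemC g u).mp hu)])
  rw [Finset.sum_eq_single (rep g) (fun u hu hne => hsingle u hu hne)
    (fun h => absurd (Finset.min'_mem _ _) h)]
  have hrr : rep (rep g) = rep g := hrep_eq g (rep g) (hrep_mem g)
  rw [if_pos hrr]
  -- periodicity: x (rep g) = x (g + (rep g - g)) = x g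
  have := hx g (rep g - g) (by
    have h := H.neg_mem (hrep_mem g); rwa [neg_sub] at h)
  rwa [add_sub_cancel] at this

end Transversal

/-! ## Bridge to Mathlib's group algebra `AddMonoidAlgebra 𝔽₂ G` -/

section Bridge

variable {G : Type*} [Fintype G]

/-- The element of Mathlib's group algebra `AddMonoidAlgebra 𝔽₂ G` with coefficient function `u` (after qec-lit-3's private
`toAlg` in `AbelianTwoBlockPaddedLogicals.lean`). [folklore] -/
noncomputable def toAlg (u : G → ZMod 2) : AddMonoidAlgebra (ZMod 2) G :=
  .ofCoeff (Finsupp.equivFunOnFinite.symm u)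

/-- The coefficient function of `toAlg u` is `u`. [folklore] -/
theorem coe_coeff_toAlg (u : G → ZMod 2) : ⇑(toAlg u).coeff = u := by
  funext g; simp [toAlg]

/-- `toAlg` of the coefficient function of `x` is `x`. [folklore] -/
theorem toAlg_coe_coeff (x : AddMonoidAlgebra (ZMod 2) G) : toAlg ⇑x.coeff = x := by
  apply AddMonoidAlgebra.coeff_injective
  ext g
  rw [coe_coeff_toAlg]

/-- `toAlg` is injective. [folklore] -/
theorem toAlg_injective : Function.Injective (toAlg : (G → ZMod 2) → AddMonoidAlgebra (ZMod 2) G) := by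
  intro u v h
  rw [← coe_coeff_toAlg u, ← coe_coeff_toAlg v, h]

variable [AddCommGroup G]

/-- Mathlib's product on `AddMonoidAlgebra 𝔽₂ G`, read on coefficient functions, is the circulant (convolution) product
`u ⋆ v = circulant u *ᵥ v` (qec-lit-3's private `coe_coeff_mul`, re-proved). [folklore] -/
theorem coe_coeff_mul (x y : AddMonoidAlgebra (ZMod 2) G) :
    ⇑(x * y).coeff = circulant ⇑x.coeff *ᵥ ⇑y.coeff := by
  classical
  funext g
  have hs : ∀ {p : G × G}, p ∈ Finset.univ.image (fun h : G => (g - h, h)) ↔ p.1 + p.2 = g := by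
    intro p
    simp only [Finset.mem_image, Finset.mem_univ, true_and]
    constructor
    · rintro ⟨h, rfl⟩
      exact sub_add_cancel g h
    · intro hp
      exact ⟨p.2, by rw [← hp, add_sub_cancel_right]⟩
  rw [AddMonoidAlgebra.coeff_mul_antidiag x y g _ hs,
    Finset.sum_image (by intro h₁ _ h₂ _ h; exact (Prod.ext_iff.mp h).2)]
  simp [Matrix.mulVec, dotProduct, Matrix.circulant_apply]

/-- `toAlg (u ⋆ v) = toAlg u * toAlg v`. [folklore] -/
theorem toAlg_conv (u v : G → ZMod 2) : toAlg (circulant u *ᵥ v) = toAlg u * toAlg v := by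
  apply AddMonoidAlgebra.coeff_injective
  apply DFunLike.coe_injective
  rw [coe_coeff_toAlg, coe_coeff_mul, coe_coeff_toAlg, coe_coeff_toAlg]

/-- `toAlg 0 = 0`. [folklore] -/
theorem toAlg_zero : toAlg (0 : G → ZMod 2) = 0 := by
  apply AddMonoidAlgebra.coeff_injective
  apply DFunLike.coe_injective
  rw [coe_coeff_toAlg]; rfl

omit [AddCommGroup G] in
/-- `toAlg δ_g = single g 1`. [folklore] -/
theorem toAlg_single [DecidableEq G] (g : G) : toAlg (Pi.single g (1 : ZMod 2)) = AddMonoidAlgebra.single g 1 := by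
  apply AddMonoidAlgebra.coeff_injective
  apply DFunLike.coe_injective
  rw [coe_coeff_toAlg, AddMonoidAlgebra.coeff_single]
  funext h
  simp [Pi.single_apply, Finsupp.single_apply, eq_comm]

/-- `toAlg (u + v) = toAlg u + toAlg v`. [folklore] -/
theorem toAlg_add (u v : G → ZMod 2) : toAlg (u + v) = toAlg u + toAlg v := by
  apply AddMonoidAlgebra.coeff_injective
  apply DFunLike.coe_injective
  rw [coe_coeff_toAlg, AddMonoidAlgebra.coeff_add, Finsupp.coe_add, coe_coeff_toAlg, coe_coeff_toAlg]

end Bridge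

/-! ## Characteristic-two identities in the group algebra: `(1 + Y)^(2^j) = 1 + Y^(2^j)`, `(1+Y)^(2^r - 1) = Σ_{l<2^r} Y^l` -/

section CharTwoAlg

variable {G : Type*} [AddCommGroup G]

/-- `x + x = 0` in `𝔽₂[G]`. -/
theorem alg_add_self (x : AddMonoidAlgebra (ZMod 2) G) : x + x = 0 := by
  rw [← two_smul (ZMod 2) x, show (2 : ZMod 2) = 0 from rfl, zero_smul]

/-- Frobenius: `(1 + Y)^(2^j) = 1 + Y^(2^j)` in `𝔽₂[G]`. -/
theorem one_add_pow_two_pow (Y : AddMonoidAlgebra (ZMod 2) G) (j : ℕ) : (1 + Y) ^ (2 ^ j) = 1 + Y ^ (2 ^ j) := by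
  induction j with
  | zero => simp
  | succ j ih =>
    rw [pow_succ, pow_mul, ih, add_sq, mul_assoc, two_mul, alg_add_self, add_zero, one_pow, ← pow_mul]

/-- The binary-expansion identity `∏_{j<r} (1 + Y^(2^j)) = Σ_{l<2^r} Y^l` (any commutative ring). -/
theorem prod_one_add_pow_two_pow {S : Type*} [CommRing S] (Y : S) (r : ℕ) :
    ∏ j ∈ Finset.range r, (1 + Y ^ (2 ^ j)) = ∑ l ∈ Finset.range (2 ^ r), Y ^ l := by
  induction r with
  | zero => simp
  | succ r ih =>
    rw [Finset.prod_range_succ, ih, pow_succ, mul_two, Finset.sum_range_add, mul_add, mul_one, Finset.sum_mul]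
    congr 1
    refine Finset.sum_congr rfl fun l _ => ?_
    rw [← pow_add, add_comm]

/-- `Σ_{j<r} 2^j = 2^r - 1`. -/
theorem sum_two_pow (r : ℕ) : ∑ j ∈ Finset.range r, 2 ^ j = 2 ^ r - 1 := by
  induction r with
  | zero => simp
  | succ r ih => rw [Finset.sum_range_succ, ih, pow_succ]; omega

/-- `(1 + Y)^(2^r - 1) = Σ_{l<2^r} Y^l` in `𝔽₂[G]`. -/
theorem one_add_pow_two_pow_sub_one (Y : AddMonoidAlgebra (ZMod 2) G) (r : ℕ) :
    (1 + Y) ^ (2 ^ r - 1) = ∑ l ∈ Finset.range (2 ^ r), Y ^ l := by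
  rw [← prod_one_add_pow_two_pow, ← sum_two_pow, ← Finset.prod_pow_eq_pow_sum]
  refine Finset.prod_congr rfl fun j _ => ?_
  exact one_add_pow_two_pow Y j

end CharTwoAlg

end Summit.Ventures.QEC.TwoBlockCyclicKernel
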